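import Literature.Probability.LatticeModels.VillainMonotonicityProofs
import HarnessLib

/-!
# Ginibre monotonicity of the Villain two-point function with PINNED (zero boundary condition)
# vertices

Support file for the named fact
`Literature.Probability.LatticeModels.FrohlichSpencerVillainSpinWaveBound` (`VillainSpinWave.lean`:
Fröhlich–Spencer 1982 as printed in Dario–Wu 2020, Prop. 1.1, whose first clause is the existence
of the thermodynamic limit of the zero-boundary-condition Villain two-point functions — "a
consequence of correlation inequalities [Gi, BFL, MMP]", Dario–Wu p. 4). The tree PROVES Ginibre's
monotonicity for the Villain model with all vertices free
(`AizenmanHarelPeledShapiro2021_villainTwoPoint_mono_holds`, `VillainMonotonicityProofs.lean`: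
Ginibre's duplicated-variables frame on the torus `U(1)^V` plus the Gaussian–`sinh/cosh`
re-indexing of products of theta series). Here we run THE SAME argument for edges whose end-points
may be PINNED to the angle `0` (end-points in `Option V`, `none` = the grounded boundary): for
stiffnesses `0 < κ_e ≤ κ'_e`,

  `(∫ cos(θ̄_a − θ̄_b) W_κ)(∫ W_κ') ≤ (∫ cos(θ̄_a − θ̄_b) W_κ')(∫ W_κ)`
  (`setIntegral_cos_mul_pinnedWeight_mul_le`), i.e. `⟨cos(θ̄_a − θ̄_b)⟩_κ ≤ ⟨cos(θ̄_a − θ̄_b)⟩_κ'`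
  (`pinnedVillainTwoPoint_mono`),

`W_κ(θ) = ∏_e v_{κ_e}(θ̄(t e) − θ̄(s e))`, `θ̄(some v) = θ_v`, `θ̄(none) = 0`
(`θ̄ o = o.elim 0 θ`), integrals over the angle cube `[-π, π)^V`. Raising the stiffness of the
edges to the grounded boundary is how the zero boundary condition of a smaller cube is imposed on a
larger one (the pinning limit `κ → ∞` is taken in a companion file), whence the monotonicity of
the zero-boundary-condition two-point function in the volume and its thermodynamic limit.
The only change with respect to the tree's proof is that the edge "difference functionals"
`θ ↦ θ̄(t e) − θ̄(s e)` and the observable are composed with the zero extension `θ ↦ θ̄`, which is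
still additive — all the positivity machinery (`exists_isPosKernel_tendsto_villainEdge_sub/add`,
`exists_isPosKernel_tendsto_prod_sub_prod`, `integral_nonneg_of_exists_isPosKernel_tendsto`,
`integral_mul_integral_le_of_dup_nonneg`) is imported, not re-proved. Theorems only; no
definition and no named fact is introduced.

## References

* [Ginibre1970] J. Ginibre, Comm. Math. Phys. 16 (1970) 310–328 (main theorem; plane rotators).
* [AizenmanHarelPeledShapiro2021] M. Aizenman, M. Harel, R. Peled, J. Shapiro, arXiv:2110.09498,
  §11.3 Cor. 11.4 ("monotone in the coupling constants along each edge, and hence in the volume").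
* [DarioWu2020] P. Dario, W. Wu, arXiv:2002.02946, Ch. 1 §1 (PDF p. 4) (thermodynamic limit of the
  zero-boundary-condition Villain measures by correlation inequalities).
-/

noncomputable section

open MeasureTheory Filter Finset Set
open scoped Topology BigOperators

namespace Literature.Probability.LatticeModels

open Literature.MathematicalPhysics.QuantumFieldTheory

variable {V ι : Type*} [Fintype V] [Fintype ι]

omit [Fintype V] in
/-- The zero extension `θ̄` to `Option V` is additive. [folklore] -/
theorem option_elim_add (θ θ' : V → ℝ) (o : Option V) :
    o.elim (0 : ℝ) (θ + θ') = o.elim 0 θ + o.elim 0 θ' := by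
  cases o <;> simp

omit [Fintype V] in
/-- The zero extension `θ̄` to `Option V` commutes with subtraction. [folklore] -/
theorem option_elim_sub (θ θ' : V → ℝ) (o : Option V) :
    o.elim (0 : ℝ) (θ - θ') = o.elim 0 θ - o.elim 0 θ' := by
  cases o <;> simp

omit [Fintype V] in
/-- The zero extension is continuous in `θ`. [folklore] -/
theorem continuous_option_elim (o : Option V) : Continuous fun θ : V → ℝ => o.elim (0 : ℝ) θ := by
  cases o with
  | none => exact continuous_const
  | some v => exact continuous_apply v

/-- **Ginibre monotonicity for the Villain model with pinned vertices (product form).** On a finite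
vertex set `V` with edges `e : ι` whose end-points `s e, t e ∈ Option V` are either free vertices
(`some v`, angle `θ_v`) or the grounded boundary (`none`, angle `0`), with edge weights
`v_{κ_e}(θ̄(t e) − θ̄(s e))`: if `0 < κ_e ≤ κ'_e` for every edge then for all `a, b ∈ Option V`
`(∫ cos(θ̄_a − θ̄_b) W_κ)(∫ W_κ') ≤ (∫ cos(θ̄_a − θ̄_b) W_κ')(∫ W_κ)` (integrals over `[-π, π)^V`).
Proof: Ginibre's duplicated-variables frame on `U(1)^V` exactly as in the tree's proof of
Aizenman–Harel–Peled–Shapiro 2021 Cor. 11.4, the zero extension being additive.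
[cite: Ginibre1970, main theorem with the plane-rotator example cos(m·φ)] -/
theorem setIntegral_cos_mul_pinnedWeight_mul_le (s t : ι → Option V) {κ κ' : ι → ℝ}
    (hκ : ∀ e, 0 < κ e) (hκκ' : ∀ e, κ e ≤ κ' e) (a b : Option V) :
    (∫ θ in angleCube V, Real.cos (a.elim (0 : ℝ) θ - b.elim 0 θ) *
        ∏ e, villainKernel (κ e) ((t e).elim (0 : ℝ) θ - (s e).elim 0 θ)) *
      (∫ θ in angleCube V, ∏ e, villainKernel (κ' e) ((t e).elim (0 : ℝ) θ - (s e).elim 0 θ)) ≤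
    (∫ θ in angleCube V, Real.cos (a.elim (0 : ℝ) θ - b.elim 0 θ) *
        ∏ e, villainKernel (κ' e) ((t e).elim (0 : ℝ) θ - (s e).elim 0 θ)) *
      (∫ θ in angleCube V, ∏ e, villainKernel (κ e) ((t e).elim (0 : ℝ) θ - (s e).elim 0 θ)) := by
  have hκ' : ∀ e, 0 < κ' e := fun e => (hκ e).trans_le (hκκ' e)
  haveI : (haarProbability Circle).IsHaarMeasure := by
    unfold haarProbability; infer_instance
  -- the torus `U(1)^V`, its Haar probability measure, and the model transported to it
  set μ : Measure (V → Circle) := Measure.pi fun _ => haarProbability Circle with hμdef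
  set E : (V → ℝ) → (V → Circle) := fun θ v => Circle.exp (θ v) with hEdef
  -- the extension of a torus point to `Option V` by `1` at the grounded boundary
  set ext : (V → Circle) → Option V → Circle := fun u o => o.elim 1 u with hextdef
  set Wt : (ι → ℝ) → (V → Circle) → ℝ := fun k u =>
    ∏ e, villainKernel (k e) (Complex.arg ((ext u (t e) / ext u (s e) : Circle) : ℂ)) with hWtdef
  set ft : (V → Circle) → ℝ := fun u => ((ext u a / ext u b : Circle) : ℂ).re with hftdef
  have hext_cont : ∀ o : Option V, Continuous fun u : V → Circle => ext u o := by
    intro o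
    cases o with
    | none => exact continuous_const
    | some v => exact continuous_apply v
  have hWc : ∀ k : ι → ℝ, (∀ e, 0 < k e) → Continuous (Wt k) := fun k hk =>
    continuous_finsetProd _ fun e _ => (continuous_villainKernel_arg (hk e)).comp
      ((hext_cont (t e)).div' (hext_cont (s e)))
  have hWpos : ∀ k : ι → ℝ, (∀ e, 0 < k e) → ∀ u, 0 < Wt k u := fun k hk u =>
    Finset.prod_pos fun e _ => villainKernel_pos (hk e) _
  have hfc : Continuous ft := Complex.continuous_re.comp
    (continuous_subtype_val.comp ((hext_cont a).div' (hext_cont b)))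
  -- pull-backs along `θ ↦ (e^{iθ_v})_v`
  have harg : ∀ β r : ℝ, villainKernel β (Complex.arg (Circle.exp r : ℂ)) = villainKernel β r :=
    fun β r => by
    rw [Circle.coe_exp, Complex.arg_exp_mul_I, toIocMod]
    exact (show Function.Periodic (villainKernel β) (2 * Real.pi) from
      villainKernel_add_two_pi β).sub_zsmul_eq _
  have hextE : ∀ (θ : V → ℝ) (o : Option V), ext (E θ) o = Circle.exp (o.elim (0 : ℝ) θ) := by
    intro θ o
    cases o with
    | none => simp [hextdef]
    | some v => simp [hextdef, hEdef]
  have hWE : ∀ (k : ι → ℝ) (θ : V → ℝ),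
      Wt k (E θ) = ∏ e, villainKernel (k e) ((t e).elim (0 : ℝ) θ - (s e).elim 0 θ) := fun k θ => by
    simp only [hWtdef]
    refine Finset.prod_congr rfl fun e _ => ?_
    rw [hextE, hextE, ← Circle.exp_sub, harg]
  have hfE : ∀ θ : V → ℝ, ft (E θ) = Real.cos (a.elim (0 : ℝ) θ - b.elim 0 θ) := fun θ => by
    simp only [hftdef]
    rw [hextE, hextE, ← Circle.exp_sub, Circle.coe_exp, Complex.exp_ofReal_mul_I_re]
  -- Haar integrals over `U(1)^V` are angle integrals over the cube `[-π, π)^V`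
  have htr : ∀ G : (V → Circle) → ℝ, Continuous G →
      ∫ u, G u ∂μ = ((2 * Real.pi)⁻¹) ^ Fintype.card V * ∫ θ in angleCube V, G (E θ) :=
    fun G hG => by
    rw [hμdef, CircleHaar.integral_pi_haarProbability_circle G hG.aestronglyMeasurable,
      CircleHaar.setIntegral_pi_Ioc_eq_pi_Ico, smul_eq_mul]
    rfl
  have hc : (0 : ℝ) < ((2 * Real.pi)⁻¹) ^ Fintype.card V := by positivity
  -- transport the claim to the torus
  have hnum : ∀ k : ι → ℝ, (∀ e, 0 < k e) →
      ∫ θ in angleCube V, Real.cos (a.elim (0 : ℝ) θ - b.elim 0 θ) *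
          ∏ e, villainKernel (k e) ((t e).elim (0 : ℝ) θ - (s e).elim 0 θ) =
        (((2 * Real.pi)⁻¹) ^ Fintype.card V)⁻¹ * ∫ u, ft u * Wt k u ∂μ := fun k hk => by
    rw [htr (fun u => ft u * Wt k u) (hfc.mul (hWc k hk)), ← mul_assoc, inv_mul_cancel₀ hc.ne', one_mul]
    simp only [hWE, hfE]
  have hden : ∀ k : ι → ℝ, (∀ e, 0 < k e) →
      ∫ θ in angleCube V, ∏ e, villainKernel (k e) ((t e).elim (0 : ℝ) θ - (s e).elim 0 θ) =
        (((2 * Real.pi)⁻¹) ^ Fintype.card V)⁻¹ * ∫ u, Wt k u ∂μ := fun k hk => by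
    rw [htr _ (hWc k hk), ← mul_assoc, inv_mul_cancel₀ hc.ne', one_mul]
    simp only [hWE]
  rw [hnum κ hκ, hnum κ' hκ', hden κ hκ, hden κ' hκ']
  have hc' : (0 : ℝ) < (((2 * Real.pi)⁻¹) ^ Fintype.card V)⁻¹ := inv_pos.2 hc
  rw [show (((2 * Real.pi)⁻¹) ^ Fintype.card V)⁻¹ * (∫ u, ft u * Wt κ u ∂μ) *
      ((((2 * Real.pi)⁻¹) ^ Fintype.card V)⁻¹ * ∫ u, Wt κ' u ∂μ) =
      (((2 * Real.pi)⁻¹) ^ Fintype.card V)⁻¹ ^ 2 * ((∫ u, ft u * Wt κ u ∂μ) * ∫ u, Wt κ' u ∂μ) by ring,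
    show (((2 * Real.pi)⁻¹) ^ Fintype.card V)⁻¹ * (∫ u, ft u * Wt κ' u ∂μ) *
      ((((2 * Real.pi)⁻¹) ^ Fintype.card V)⁻¹ * ∫ u, Wt κ u ∂μ) =
      (((2 * Real.pi)⁻¹) ^ Fintype.card V)⁻¹ ^ 2 * ((∫ u, ft u * Wt κ' u ∂μ) * ∫ u, Wt κ u ∂μ) by ring]
  refine mul_le_mul_of_nonneg_left ?_ (by positivity)
  refine integral_mul_integral_le_of_dup_nonneg μ exists_mul_self_circlePi hfc (hWc κ hκ)
    (hWc κ' hκ') (fun u => (hWpos κ hκ u).ne') ?_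
  -- ## positivity of the duplicated integral: pull it back to the angle cube
  set G : (V → Circle) × (V → Circle) → ℝ := fun p =>
    (ft (p.1 * p.2) - ft (p.1 * p.2⁻¹)) *
      (Wt κ' (p.1 * p.2) * Wt κ (p.1 * p.2⁻¹) - Wt κ (p.1 * p.2) * Wt κ' (p.1 * p.2⁻¹)) with hGdef
  have hGc : Continuous G := by
    have h1 := hWc κ hκ
    have h2 := hWc κ' hκ'
    rw [hGdef]
    fun_prop
  set νa : Measure (V → ℝ) := Measure.pi fun _ : V => CircleHaar.angleMeasure with hνadef
  have hmp : MeasurePreserving (Prod.map E E) (νa.prod νa) (μ.prod μ) :=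
    CircleHaar.measurePreserving_exp_pi.prod CircleHaar.measurePreserving_exp_pi
  rw [← hmp.map_eq, integral_map hmp.measurable.aemeasurable hGc.aestronglyMeasurable]
  -- the pulled-back integrand
  have hEmul : ∀ α β : V → ℝ, E α * E β = E (α + β) := fun α β => funext fun v => by
    simp only [hEdef, Pi.mul_apply, Pi.add_apply, Circle.exp_add]
  have hEdiv : ∀ α β : V → ℝ, E α * (E β)⁻¹ = E (α - β) := fun α β => funext fun v => by
    simp only [hEdef, Pi.mul_apply, Pi.inv_apply, Pi.sub_apply, Circle.exp_sub, div_eq_mul_inv]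
  -- the edge difference functionals and the observable difference, through the zero extension
  obtain ⟨D, hD⟩ : ∃ D : ι → (V → ℝ) → ℝ, ∀ e θ, D e θ = (t e).elim (0 : ℝ) θ - (s e).elim 0 θ :=
    ⟨_, fun _ _ => rfl⟩
  obtain ⟨O, hO⟩ : ∃ O : (V → ℝ) → ℝ, ∀ θ, O θ = a.elim (0 : ℝ) θ - b.elim 0 θ := ⟨_, fun _ => rfl⟩
  have hDc : ∀ e, Continuous (D e) := fun e => by
    rw [show D e = fun θ => (t e).elim (0 : ℝ) θ - (s e).elim 0 θ from funext (hD e)]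
    exact (continuous_option_elim (t e)).sub (continuous_option_elim (s e))
  have hDadd : ∀ e (α β : V → ℝ), D e (α + β) = D e α + D e β := fun e α β => by
    simp only [hD, option_elim_add]; ring
  have hDsub : ∀ e (α β : V → ℝ), D e (α - β) = D e α - D e β := fun e α β => by
    simp only [hD, option_elim_sub]; ring
  have hOc : Continuous O := by
    rw [show O = fun θ => a.elim (0 : ℝ) θ - b.elim 0 θ from funext hO]
    exact (continuous_option_elim a).sub (continuous_option_elim b)
  have hOadd : ∀ α β : V → ℝ, O (α + β) = O α + O β := fun α β => by
    simp only [hO, option_elim_add]; ring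
  have hOsub : ∀ α β : V → ℝ, O (α - β) = O α - O β := fun α β => by
    simp only [hO, option_elim_sub]; ring
  have hWE' : ∀ (k : ι → ℝ) (θ : V → ℝ), Wt k (E θ) = ∏ e, villainKernel (k e) (D e θ) := fun k θ => by
    rw [hWE]; simp only [hD]
  have hfE' : ∀ θ : V → ℝ, ft (E θ) = Real.cos (O θ) := fun θ => by rw [hfE, hO]
  have hΦ : ∀ q : (V → ℝ) × (V → ℝ), G (Prod.map E E q) =
      2 * (Real.sin (O q.1) * Real.sin (O q.2)) *
        (∏ e, villainKernel (κ e) (D e q.1 + D e q.2) * villainKernel (κ' e) (D e q.1 - D e q.2) -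
          ∏ e, villainKernel (κ' e) (D e q.1 + D e q.2) * villainKernel (κ e) (D e q.1 - D e q.2)) := by
    rintro ⟨α, β⟩
    simp only [hGdef, Prod.map_apply]
    rw [hEmul, hEdiv, hWE', hWE', hWE', hWE', hfE', hfE']
    simp only [hOadd, hOsub, hDadd, hDsub]
    rw [Real.cos_add, Real.cos_sub, ← Finset.prod_mul_distrib, ← Finset.prod_mul_distrib]
    ring
  rw [integral_congr_ae (ae_of_all _ hΦ)]
  -- continuous functions are integrable for the (compactly supported) angle measure
  have hint : ∀ g : (V → ℝ) → ℝ, Continuous g → Integrable g νa := fun g hg => by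
    rw [hνadef, CircleHaar.pi_angleMeasure]
    refine Integrable.smul_measure ?_
      (ENNReal.pow_ne_top (ENNReal.inv_ne_top.2 CircleHaar.ofReal_two_pi_ne_zero))
    refine (hg.continuousOn.integrableOn_compact
      (isCompact_Icc (a := fun _ : V => -Real.pi) (b := fun _ => Real.pi))).mono_set ?_
    rw [← Set.pi_univ_Icc]
    exact Set.pi_mono fun _ _ => Set.Ioc_subset_Icc_self
  refine integral_nonneg_of_exists_isPosKernel_tendsto νa hint ?_
  -- the integrand is a bounded limit of positive kernels
  have hsin : IsPosKernel (fun p : (V → ℝ) × (V → ℝ) => 2 * (Real.sin (O p.1) * Real.sin (O p.2))) :=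
    (isPosKernel_mul_self (Real.continuous_sin.comp hOc)).const_mul zero_le_two
  have hsinb : ∀ p : (V → ℝ) × (V → ℝ), |2 * (Real.sin (O p.1) * Real.sin (O p.2))| ≤ 2 := fun p => by
    rw [abs_mul, abs_mul, abs_two]
    have := Real.abs_sin_le_one (O p.1)
    have := Real.abs_sin_le_one (O p.2)
    nlinarith [abs_nonneg (Real.sin (O p.1)), abs_nonneg (Real.sin (O p.2))]
  have hedges := exists_isPosKernel_tendsto_prod_sub_prod (X := V → ℝ) (Finset.univ : Finset ι)
    (A := fun e p => villainKernel (κ' e) (D e p.1 + D e p.2) * villainKernel (κ e) (D e p.1 - D e p.2))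
    (B := fun e p => villainKernel (κ e) (D e p.1 + D e p.2) * villainKernel (κ' e) (D e p.1 - D e p.2))
    (fun e _ => exists_isPosKernel_tendsto_villainEdge_sub (X := V → ℝ) (hDc e) (hκ e) (hκκ' e))
    (fun e _ => exists_isPosKernel_tendsto_villainEdge_add (X := V → ℝ) (hDc e) (hκ e) (hκκ' e))
  exact exists_isPosKernel_tendsto_mul (exists_isPosKernel_tendsto_of_isPosKernel hsin hsinb) hedges.1

/-- The pinned Villain partition function `∫_{[-π,π)^V} ∏_e v_{κ_e}(θ̄(t e) − θ̄(s e)) dθ` is positive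
(`κ_e > 0`). [folklore] -/
theorem setIntegral_pinnedWeight_pos (s t : ι → Option V) {κ : ι → ℝ} (hκ : ∀ e, 0 < κ e) :
    0 < ∫ θ in angleCube V, ∏ e, villainKernel (κ e) ((t e).elim (0 : ℝ) θ - (s e).elim 0 θ) := by
  have hWc : Continuous fun θ : V → ℝ => ∏ e, villainKernel (κ e) ((t e).elim (0 : ℝ) θ - (s e).elim 0 θ) :=
    continuous_finsetProd _ fun e _ => (continuous_villainKernel (hκ e)).comp
      ((continuous_option_elim (t e)).sub (continuous_option_elim (s e)))
  have hWpos : ∀ θ : V → ℝ, 0 < ∏ e, villainKernel (κ e) ((t e).elim (0 : ℝ) θ - (s e).elim 0 θ) :=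
    fun θ => Finset.prod_pos fun e _ => villainKernel_pos (hκ e) _
  have hmeas : MeasurableSet (angleCube V) := MeasurableSet.univ_pi fun _ => measurableSet_Ico
  have hvol : volume (angleCube V) < ⊤ := by
    refine Bornology.IsBounded.measure_lt_top ?_
    refine (Metric.isBounded_Icc (fun _ => -Real.pi : V → ℝ) (fun _ => Real.pi)).subset ?_
    intro θ hθ
    simp only [angleCube, Set.mem_pi, Set.mem_univ, forall_const, Set.mem_Ico] at hθ
    exact ⟨fun v => (hθ v).1, fun v => (hθ v).2.le⟩
  have hvol0 : volume (angleCube V) ≠ 0 := by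
    rw [angleCube, volume_pi, Measure.pi_pi]
    refine Finset.prod_ne_zero_iff.2 fun v _ => ?_
    rw [Real.volume_Ico]
    exact (ENNReal.ofReal_pos.2 (by linarith [Real.pi_pos])).ne'
  -- the closed cube, on which the weight attains a positive minimum
  have hK : IsCompact (Set.pi univ fun _ : V => Icc (-Real.pi) Real.pi) :=
    isCompact_univ_pi fun _ => isCompact_Icc
  have hKne : (Set.pi univ fun _ : V => Icc (-Real.pi) Real.pi).Nonempty :=
    Set.univ_pi_nonempty_iff.2 fun _ => nonempty_Icc.2 (by linarith [Real.pi_pos])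
  have hsub : angleCube V ⊆ Set.pi univ fun _ : V => Icc (-Real.pi) Real.pi :=
    Set.pi_mono fun _ _ => Ico_subset_Icc_self
  obtain ⟨θ₀, -, hmin⟩ := hK.exists_isMinOn hKne hWc.continuousOn
  have hWint : IntegrableOn
      (fun θ : V → ℝ => ∏ e, villainKernel (κ e) ((t e).elim (0 : ℝ) θ - (s e).elim 0 θ)) (angleCube V) :=
    (hWc.continuousOn.integrableOn_compact hK).mono_set hsub
  calc (0 : ℝ) < (∏ e, villainKernel (κ e) ((t e).elim (0 : ℝ) θ₀ - (s e).elim 0 θ₀)) *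
        (volume (angleCube V)).toReal := mul_pos (hWpos θ₀) (ENNReal.toReal_pos hvol0 hvol.ne)
    _ = ∫ _ in angleCube V, ∏ e, villainKernel (κ e) ((t e).elim (0 : ℝ) θ₀ - (s e).elim 0 θ₀) := by
        rw [setIntegral_const, smul_eq_mul, measureReal_def, mul_comm]
    _ ≤ ∫ θ in angleCube V, ∏ e, villainKernel (κ e) ((t e).elim (0 : ℝ) θ - (s e).elim 0 θ) :=
        setIntegral_mono_on (integrableOn_const hvol.ne) hWint hmeas fun θ hθ => hmin (hsub hθ)

/-- **Ginibre monotonicity for the Villain model with pinned vertices (ratio form)**: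
`⟨cos(θ̄_a − θ̄_b)⟩_κ ≤ ⟨cos(θ̄_a − θ̄_b)⟩_{κ'}` for `0 < κ_e ≤ κ'_e`, where
`⟨F⟩_κ = (∫ F W_κ)/(∫ W_κ)`, `W_κ(θ) = ∏_e v_{κ_e}(θ̄(t e) − θ̄(s e))` with end-points in `Option V`
(`none` = pinned to the angle `0`). With all end-points free this is the tree's
`AizenmanHarelPeledShapiro2021_villainTwoPoint_mono_holds` (whose simple-graph hypotheses are not
needed). [cite: AizenmanHarelPeledShapiro2021, Cor. 11.4 (with §11, first paragraph)] -/
theorem pinnedVillainTwoPoint_mono (s t : ι → Option V) {κ κ' : ι → ℝ}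
    (hκ : ∀ e, 0 < κ e) (hκκ' : ∀ e, κ e ≤ κ' e) (a b : Option V) :
    (∫ θ in angleCube V, Real.cos (a.elim (0 : ℝ) θ - b.elim 0 θ) *
        ∏ e, villainKernel (κ e) ((t e).elim (0 : ℝ) θ - (s e).elim 0 θ)) /
      (∫ θ in angleCube V, ∏ e, villainKernel (κ e) ((t e).elim (0 : ℝ) θ - (s e).elim 0 θ)) ≤
    (∫ θ in angleCube V, Real.cos (a.elim (0 : ℝ) θ - b.elim 0 θ) *
        ∏ e, villainKernel (κ' e) ((t e).elim (0 : ℝ) θ - (s e).elim 0 θ)) /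
      (∫ θ in angleCube V, ∏ e, villainKernel (κ' e) ((t e).elim (0 : ℝ) θ - (s e).elim 0 θ)) := by
  have hκ' : ∀ e, 0 < κ' e := fun e => (hκ e).trans_le (hκκ' e)
  rw [div_le_div_iff₀ (setIntegral_pinnedWeight_pos s t hκ) (setIntegral_pinnedWeight_pos s t hκ')]
  exact setIntegral_cos_mul_pinnedWeight_mul_le s t hκ hκκ' a b

end Literature.Probability.LatticeModels
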